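import Summits.MatrixMultiplication.MatrixMultiplication.Theorems.AbelianSTPPCensusTAStatDDefs

/-!
# T_A certificate, fourth range `6191 … 6379` (static t*-indexed linear checker, free budget parameter, two-member fallback): kernel evaluation, shape checks, volumes `4120 … 4643`

Cell mm-stpp (rung F-M1), threshold T_A = `τ = 2.371`; checker in `AbelianSTPPCensusTAStatDDefs.lean`, table in `AbelianSTPPCensusTAStatDData.lean`.
`decide` with kernel reduction (standard axioms; no `native_decide`), `Elab.async false`; consumed by `TAStatD.checkV_sound` / `TAStatD.domV_sound` / `TAStatD.m2V_sound`
in the leaf `AbelianSTPPCensusLeafTA6379Closed.lean`.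
WHAT THIS IS NOT: arithmetic on shape lists only; no statement about STPP families or `ω`.
-/

set_option linter.dupNamespace false
set_option autoImplicit false
set_option Elab.async false

namespace Summit.MatrixMultiplication.MatrixMultiplication.Theorems.TAStatD

set_option maxHeartbeats 0 in
/-- Check chunk: every sorted candidate shape of the volumes `4120 … 4241` passes `checkShape` (44718 (shape, bucket) checks). [original] -/
theorem ck4120 : TAStatD.checkV 122 4120 = true := by decide +kernel

set_option maxHeartbeats 0 in
/-- Check chunk: every sorted candidate shape of the volumes `4242 … 4375` passes `checkShape` (44899 (shape, bucket) checks). [original] -/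
theorem ck4242 : TAStatD.checkV 134 4242 = true := by decide +kernel

set_option maxHeartbeats 0 in
/-- Check chunk: every sorted candidate shape of the volumes `4376 … 4511` passes `checkShape` (44227 (shape, bucket) checks). [original] -/
theorem ck4376 : TAStatD.checkV 136 4376 = true := by decide +kernel

set_option maxHeartbeats 0 in
/-- Check chunk: every sorted candidate shape of the volumes `4512 … 4643` passes `checkShape` (43793 (shape, bucket) checks). [original] -/
theorem ck4512 : TAStatD.checkV 132 4512 = true := by decide +kernel

end Summit.MatrixMultiplication.MatrixMultiplication.Theorems.TAStatD
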